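import Summits.CriticalPhenomena.Ising3DConformalLimit.Theses.UnitLightCone
import Summits.CriticalPhenomena.Ising3DConformalLimit.Theses.MirrorHoelderCompactness
import Summits.CriticalPhenomena.Ising3DConformalLimit.Theorems.HyperoctahedralRPExistsScaleCovariantLimitFunnelDoublingIffAxisRate
import Summits.CriticalPhenomena.Ising3DConformalLimit.Theorems.HyperoctahedralRPExistsScaleCovariantLimitFoldedCurrentHeavyScaleDoubling
import Summits.CriticalPhenomena.Ising3DConformalLimit.Theorems.MirrorHoelderCompactnessTwoPointDoublingStubLeanScalePropagation
import Summits.CriticalPhenomena.Ising3DConformalLimit.Theorems.HyperoctahedralRPExistsScaleCovariantLimitFoldedCurrentAxisCompleteMonotonicity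
import Literature.Probability.LatticeModels.CriticalAxisRatioRegularity
import Literature.Probability.LatticeModels.MessagerMiracleSole
import Literature.Probability.LatticeModels.CriticalTwoPointLower
import Literature.Probability.LatticeModels.PointwiseScalingLimitEtaExists
import Literature.Probability.LatticeModels.HighDimPointwiseTriviality
import HarnessLib

/-!
# Strategist b1 sketch — crux `TwoPointDoubling` (stmt-CriticalPhenomena-6150), route UnitLightCone

Typed signatures for the STRATEGY CENSUS of this seat and the kernel-checked compositions behind the
two cuts it proposes.  `g(k) = criticalTwoPoint 3 (Pi.single 0 k) = ⟨σ₀σ_{k e₀}⟩⁺_{β_c(3)}`.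

* `laplacian x` — the six-neighbour lattice Laplacian of the critical two-point function at `x`.
* `OneSidedKatoBound` — the TRANSFER target of line `superharmonic-comparison`:
  `ΔG(x) ≤ A·G(x)/‖x‖²` for all `x ≠ 0` (no positive effective mass; only the positive part of
  `ΔG` is constrained).
* `AxialKatoBound`, `TransverseDipoleBound` — the two pieces of the CURVATURE SPLIT (line `curvature-split`):
  `ΔG(ke₀) ≤ A g(k)/k²` on the axis, and `g(k) − G(ke₀ + 2e₁) ≤ A g(k)/k²`.
* `twoPointDoubling_of_axialKato_of_transverseDipole` — PROVED: the two pieces give item 6150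
  (log-convexity turns the axial curvature bound into the log-free gradient bound of ADC21 Rem. 5.10,
  `Funnel.twoPointDoubling_iff_axisGradientRate`).
* `AnomalousRegimeDoubling` + `twoPointDoubling_of_anomalous` — PROVED: the regime reshape of the birth
  line (lean windows LANDED p142463, heavy scales LANDED p145487, the generic light-and-fat regime open).
* `axialKato_of_twoPointDoubling` — PROVED: 6150 ⟹ `AxialCurvatureBound` ⟹ `AxialKatoBound` (third-order complete
  monotonicity `criticalAxis_completelyMonotone` + the rate form + MMS): piece (i) of the curvature split is NECESSARY, and
  `AxialCurvatureBound ⟺ 6150`.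
* `IncrementDoubling`, `OctaveRatioCriterion`, `DLRLaplacianIdentity` — further census signatures.
-/

noncomputable section

namespace Summit.CriticalPhenomena.Ising3DConformalLimit.Cruxes.TwoPointDoubling.StrategistB1

open scoped BigOperators
open Finset Real Filter
open Literature.Probability.LatticeModels
open Summit.CriticalPhenomena.Ising3DConformalLimit.Theses
open Summit.CriticalPhenomena.Ising3DConformalLimit.Cruxes.ExistsScaleCovariantLimit

/-! ## Shorthand -/

/-- `g(m) = ⟨σ₀σ_{m e₀}⟩⁺_{β_c(3)}`. -/
def g (m : ℕ) : ℝ := criticalTwoPoint 3 (Pi.single 0 (m : ℤ))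

/-- The six-neighbour lattice Laplacian of the critical two-point function:
`ΔG(x) = Σ_{i} (G(x + eᵢ) + G(x − eᵢ)) − 6 G(x)`. -/
def laplacian (x : Site 3) : ℝ :=
  (∑ i : Fin 3, (criticalTwoPoint 3 (x + Pi.single i 1) + criticalTwoPoint 3 (x - Pi.single i 1))) -
    6 * criticalTwoPoint 3 x

/-- The DLR defect observable at `x`: `Ψ_x(σ) = S_x − 6 tanh(β_c S_x)`, `S_x = Σ_{y ∼ x} σ_y`. -/
def eomDefect (x : Site 3) (σ : SpinConfig (Site 3)) : ℝ :=
  (∑ i : Fin 3, (spinAt (x + Pi.single i 1) σ + spinAt (x - Pi.single i 1) σ)) -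
    6 * Real.tanh (criticalBeta 3 * ∑ i : Fin 3, (spinAt (x + Pi.single i 1) σ + spinAt (x - Pi.single i 1) σ))

/-! ## Census signatures -/

/-- TRANSFER TARGET `C⁺` (line `superharmonic-comparison`): one-sided scale-invariant Kato bound on the
effective potential `V = ΔG/G` — only `(ΔG)⁺` is constrained. -/
def OneSidedKatoBound : Prop :=
  ∃ A : ℝ, ∀ x : Site 3, x ≠ 0 → laplacian x ≤ A * criticalTwoPoint 3 x / ‖x‖ ^ 2

/-- The same statement written without the local shorthand (the form registered as a stub hypothesis). -/
def OneSidedKatoBoundExplicit : Prop :=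
  ∃ A : ℝ, ∀ x : Site 3, x ≠ 0 →
    (∑ i : Fin 3, (criticalTwoPoint 3 (x + Pi.single i 1) + criticalTwoPoint 3 (x - Pi.single i 1))) -
        6 * criticalTwoPoint 3 x ≤ A * criticalTwoPoint 3 x / ‖x‖ ^ 2

theorem oneSidedKatoBound_iff : OneSidedKatoBound ↔ OneSidedKatoBoundExplicit := Iff.rfl

/-- DLR reading of the Laplacian (the identity behind the line): `ΔG(x) = ⟨σ₀ Ψ_x⟩⁺_{β_c}` for `x ≠ 0`. -/
def DLRLaplacianIdentity : Prop :=
  ∀ x : Site 3, x ≠ 0 → laplacian x = plusExpect 3 (criticalBeta 3) 0 (fun σ => spinAt 0 σ * eomDefect x σ)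

/-- CURVATURE SPLIT, piece (i): one-sided Kato bound ON THE AXIS, `ΔG(ke₀) ≤ A·g(k)/k²`. A CONSEQUENCE of
item 6150 (log-convexity: `δ²g(k) ≤ A g(k)/k²` under doubling, and `ΔG(ke₀) ≤ δ²g(k)` by MMS). -/
def AxialKatoBound : Prop :=
  ∃ A : ℝ, ∀ k : ℕ, 1 ≤ k →
    (∑ i : Fin 3, (criticalTwoPoint 3 (Pi.single 0 (k : ℤ) + Pi.single i 1) +
        criticalTwoPoint 3 (Pi.single 0 (k : ℤ) - Pi.single i 1))) -
      6 * criticalTwoPoint 3 (Pi.single 0 (k : ℤ)) ≤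
      A * criticalTwoPoint 3 (Pi.single 0 (k : ℤ)) / (k : ℝ) ^ 2

/-- CURVATURE SPLIT, piece (ii): TRANSVERSE DIPOLE BOUND, `g(k) − G(ke₀ + 2e₁) ≤ A·g(k)/k²` — in Aizenman's
folded-current language the sourced critical cluster with both sources adjacent to the plane `{x₁ = 1}` avoids it
with probability `≤ A/k²`. The transverse twin of 6150 (second-order transverse curvature at the axis). -/
def TransverseDipoleBound : Prop :=
  ∃ A : ℝ, ∀ k : ℕ, 1 ≤ k →
    criticalTwoPoint 3 (Pi.single 0 (k : ℤ)) - criticalTwoPoint 3 (Pi.single 0 (k : ℤ) + Pi.single 1 2) ≤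
      A * criticalTwoPoint 3 (Pi.single 0 (k : ℤ)) / (k : ℝ) ^ 2

/-- AXIAL CURVATURE BOUND `g(k+1) − 2g(k) + g(k−1) ≤ A g(k)/k²` — equivalent to 6150 for the completely monotone `g`
(⇒ here; ⇐ census). -/
def AxialCurvatureBound : Prop :=
  ∃ A : ℝ, ∀ k : ℕ, 1 ≤ k →
    criticalTwoPoint 3 (Pi.single 0 ((k + 1 : ℕ) : ℤ)) - 2 * criticalTwoPoint 3 (Pi.single 0 (k : ℤ)) +
        criticalTwoPoint 3 (Pi.single 0 ((k - 1 : ℕ) : ℤ)) ≤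
      A * criticalTwoPoint 3 (Pi.single 0 (k : ℤ)) / (k : ℝ) ^ 2

/-- STRENGTHEN (census S2): doubling of the INCREMENTS `d_k = g(k) − g(k+1)` (also completely monotone). -/
def IncrementDoubling : Prop :=
  ∃ κ : ℝ, 0 < κ ∧ ∀ k : ℕ, 1 ≤ k →
    κ * (criticalTwoPoint 3 (Pi.single 0 (k : ℤ)) - criticalTwoPoint 3 (Pi.single 0 ((k + 1 : ℕ) : ℤ))) ≤
      criticalTwoPoint 3 (Pi.single 0 ((2 * k : ℕ) : ℤ)) - criticalTwoPoint 3 (Pi.single 0 ((2 * k + 1 : ℕ) : ℤ))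

/-- STRENGTHEN / NEGATION (census S4, N2): an OCTAVE-RATIO finite-size criterion — a universal `ε₀` such that ONE
small octave ratio of the axis two-point function at ANY inverse temperature certifies subcriticality. At `β_c`
(no exponential decay, `g ≥ c/n²`) it gives 6150 with `κ = ε₀`; it is the correlation-function analogue of Kesten's
crossing criterion. -/
def OctaveRatioCriterion : Prop :=
  ∃ ε₀ : ℝ, 0 < ε₀ ∧ ∀ β : ℝ, 0 ≤ β →
    (∃ m : ℕ, 1 ≤ m ∧ twoPointPlus 3 β (Pi.single 0 (2 * (m : ℤ))) ≤ ε₀ * twoPointPlus 3 β (Pi.single 0 (m : ℤ))) →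
      β < criticalBeta 3

/-- DECOMPOSITION (census D1): the generic (anomalous) regime left by the two landed engines — `n` LIGHT
(`n g(n) < T`) with an `A`-FAT scale `k ≤ 8n` (`g(k) > A k^{-3/2}`). -/
def AnomalousRegimeDoubling : Prop :=
  ∃ A : ℝ, 0 < A ∧ ∃ T : ℝ, 0 < T ∧ ∃ κ : ℝ, 0 < κ ∧ ∀ n : ℕ, 1 ≤ n →
    (n : ℝ) * criticalTwoPoint 3 (Pi.single 0 (n : ℤ)) < T →
    (∃ k : ℕ, 1 ≤ k ∧ k ≤ 8 * n ∧
      A * (k : ℝ) ^ (-(3 : ℝ) / 2) < criticalTwoPoint 3 (Pi.single 0 (k : ℤ))) →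
    κ * criticalTwoPoint 3 (Pi.single 0 (n : ℤ)) ≤ criticalTwoPoint 3 (Pi.single 0 (2 * (n : ℤ)))

/-! ## The two route copies of the crux agree -/

theorem ulc_iff_mhc : UnitLightCone.TwoPointDoubling ↔ MirrorHoelderCompactness.TwoPointDoubling := Iff.rfl

/-! ## Elementary facts -/

theorem g_pos (m : ℕ) : 0 < g m := Funnel.criticalTwoPoint_axis_pos 0 m

theorem criticalTwoPoint_symm_facts :
    (∀ (j : Fin 3) (x : Site 3), criticalTwoPoint 3 (Function.update x j (-x j)) = criticalTwoPoint 3 x) ∧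
    (∀ (p : Equiv.Perm (Fin 3)) (x : Site 3), criticalTwoPoint 3 (fun i => x (p i)) = criticalTwoPoint 3 x) ∧
    (∀ (x : Site 3) (i : Fin 3), 0 ≤ x i → criticalTwoPoint 3 (x + Pi.single i 1) ≤ criticalTwoPoint 3 x) := by
  have hβ : 0 ≤ criticalBeta 3 := criticalBeta_nonneg 3
  refine ⟨fun j x => ?_, fun p x => ?_, fun x i hx => ?_⟩
  · exact twoPointPlus_reflection_invariant_holds (d := 3) hβ j x
  · exact twoPointPlus_perm_invariant_holds (d := 3) hβ p x
  · exact messager_miracleSole_holds (d := 3) (β := criticalBeta 3) hβ x i hx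

/-- The four transverse neighbours of `k e₀` all carry `G(ke₀ + e₁)`, which dominates `G(ke₀ + 2e₁)` (MMS). -/
theorem transverse_nbrs_ge (k : ℕ) :
    4 * criticalTwoPoint 3 (Pi.single 0 (k : ℤ) + Pi.single 1 2) ≤
      ∑ i : Fin 3, if i = 0 then 0 else
        (criticalTwoPoint 3 (Pi.single 0 (k : ℤ) + Pi.single i 1) +
          criticalTwoPoint 3 (Pi.single 0 (k : ℤ) - Pi.single i 1)) := by
  obtain ⟨hrefl, hperm, hmms⟩ := criticalTwoPoint_symm_facts
  set x₀ : Site 3 := Pi.single 0 (k : ℤ) with hx₀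
  -- `G(ke₀ + 2e₁) ≤ G(ke₀ + e₁)`
  have h21 : criticalTwoPoint 3 (x₀ + Pi.single 1 2) ≤ criticalTwoPoint 3 (x₀ + Pi.single 1 1) := by
    have := hmms (x₀ + Pi.single 1 1) 1 (by simp [hx₀])
    have heq : x₀ + Pi.single 1 1 + Pi.single 1 1 = x₀ + Pi.single (1 : Fin 3) (2 : ℤ) := by
      rw [add_assoc, ← Pi.single_add]; norm_num
    rwa [heq] at this
  -- reflection in coordinate `i`: `G(x₀ - eᵢ) = G(x₀ + eᵢ)` for `i ≠ 0`
  have hneg : ∀ i : Fin 3, i ≠ 0 →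
      criticalTwoPoint 3 (x₀ - Pi.single i 1) = criticalTwoPoint 3 (x₀ + Pi.single i 1) := by
    intro i hi
    have := hrefl i (x₀ + Pi.single i 1)
    have heq : Function.update (x₀ + Pi.single i 1) i (-((x₀ + Pi.single i 1 : Site 3) i)) = x₀ - Pi.single i 1 := by
      funext j
      by_cases hj : j = i
      · subst hj
        simp [hx₀, Pi.single_apply, hi]
      · simp [Function.update_of_ne hj, Pi.sub_apply, Pi.add_apply, Pi.single_apply, hj]
    rw [heq] at this
    exact this
  -- permutation swapping `1` and `2`: `G(x₀ + e₂) = G(x₀ + e₁)`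
  have hswap : criticalTwoPoint 3 (x₀ + Pi.single 2 1) = criticalTwoPoint 3 (x₀ + Pi.single 1 1) := by
    have := hperm (Equiv.swap 1 2) (x₀ + Pi.single 1 1)
    have heq : (fun i => ((x₀ + Pi.single 1 1 : Site 3) (Equiv.swap (1 : Fin 3) 2 i))) = x₀ + Pi.single 2 1 := by
      funext j
      fin_cases j <;> simp [hx₀, Equiv.swap_apply_def, Pi.single_apply]
    rw [heq] at this
    exact this
  rw [Fin.sum_univ_three]
  simp only [Fin.isValue, ↓reduceIte, one_ne_zero, Fin.reduceEq, zero_add]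
  rw [hneg 1 one_ne_zero, hneg 2 (by decide), hswap]
  linarith

/-! ## CURVATURE SPLIT: pieces (i) + (ii) give item 6150 -/

/-- (i) ∧ (ii) ⟹ the axial curvature bound: `δ²g(k) = ΔG(ke₀) + (4g(k) − Σ_transverse G) ≤ (A₁ + 4A₂) g(k)/k²`. -/
theorem axialCurvature_of_axialKato_of_transverseDipole (h₁ : AxialKatoBound) (h₂ : TransverseDipoleBound) :
    AxialCurvatureBound := by
  obtain ⟨A₁, hA₁⟩ := h₁
  obtain ⟨A₂, hA₂⟩ := h₂
  refine ⟨A₁ + 4 * A₂, fun k hk => ?_⟩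
  have hL := hA₁ k hk
  have hT := hA₂ k hk
  have h4 := transverse_nbrs_ge k
  set x₀ : Site 3 := Pi.single 0 (k : ℤ) with hx₀
  -- split the Laplacian sum into the axial (`i = 0`) and transverse parts
  have hsplit : (∑ i : Fin 3, (criticalTwoPoint 3 (x₀ + Pi.single i 1) + criticalTwoPoint 3 (x₀ - Pi.single i 1))) =
      (criticalTwoPoint 3 (x₀ + Pi.single 0 1) + criticalTwoPoint 3 (x₀ - Pi.single 0 1)) +
      ∑ i : Fin 3, if i = 0 then 0 else
        (criticalTwoPoint 3 (x₀ + Pi.single i 1) + criticalTwoPoint 3 (x₀ - Pi.single i 1)) := by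
    rw [Fin.sum_univ_three, Fin.sum_univ_three]
    simp only [Fin.isValue, ↓reduceIte, one_ne_zero, Fin.reduceEq, zero_add]
    ring
  have hplus : x₀ + Pi.single 0 1 = Pi.single 0 (((k + 1 : ℕ) : ℤ)) := by
    rw [hx₀, ← Pi.single_add]; push_cast; rfl
  have hminus : x₀ - Pi.single 0 1 = Pi.single 0 (((k - 1 : ℕ) : ℤ)) := by
    rw [hx₀, ← Pi.single_sub]
    congr 1
    push_cast [Nat.cast_sub hk]
    ring
  rw [hsplit, hplus, hminus] at hL
  have hk0 : (0 : ℝ) < k := by exact_mod_cast hk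
  have hgk : 0 < criticalTwoPoint 3 x₀ := by rw [hx₀]; exact g_pos k
  -- combine
  have key : criticalTwoPoint 3 (Pi.single 0 ((k + 1 : ℕ) : ℤ)) - 2 * criticalTwoPoint 3 x₀ +
      criticalTwoPoint 3 (Pi.single 0 ((k - 1 : ℕ) : ℤ)) ≤
      A₁ * criticalTwoPoint 3 x₀ / (k : ℝ) ^ 2 + 4 * (A₂ * criticalTwoPoint 3 x₀ / (k : ℝ) ^ 2) := by
    linarith
  calc _ ≤ A₁ * criticalTwoPoint 3 x₀ / (k : ℝ) ^ 2 + 4 * (A₂ * criticalTwoPoint 3 x₀ / (k : ℝ) ^ 2) := key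
    _ = (A₁ + 4 * A₂) * criticalTwoPoint 3 x₀ / (k : ℝ) ^ 2 := by ring

/-- The axial curvature bound gives the log-free gradient bound (log-convexity `g(k)² ≤ g(k−1)g(k+1)` is exactly
`(g(k) − g(k+1))² ≤ g(k+1)·δ²g(k)`), hence item 6150 by `Funnel.twoPointDoubling_iff_axisGradientRate`. -/
theorem twoPointDoubling_of_axialCurvature (h : AxialCurvatureBound) : UnitLightCone.TwoPointDoubling := by
  rw [ulc_iff_mhc, Funnel.twoPointDoubling_iff_axisGradientRate]
  obtain ⟨A, hA⟩ := h
  refine ⟨Real.sqrt (max A 0), fun k hk => ?_⟩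
  have hk0 : (0 : ℝ) < k := by exact_mod_cast hk
  set a : ℝ := criticalTwoPoint 3 (Pi.single 0 ((k - 1 : ℕ) : ℤ)) with ha
  set b : ℝ := criticalTwoPoint 3 (Pi.single 0 (k : ℤ)) with hb
  set c : ℝ := criticalTwoPoint 3 (Pi.single 0 ((k + 1 : ℕ) : ℤ)) with hc
  have hapos : 0 < a := g_pos (k - 1)
  have hbpos : 0 < b := g_pos k
  have hcpos : 0 < c := g_pos (k + 1)
  -- log-convexity `b² ≤ a c`
  have hlc : b ^ 2 ≤ a * c := by
    have := criticalTwoPoint_axis_sq_le 0 (n := k) hk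
    simpa [ha, hb, hc] using this
  -- monotonicity `c ≤ b`
  have hcb : c ≤ b := by
    have := Funnel.criticalTwoPoint_axis_antitone 0 (Nat.le_succ k)
    simpa [hb, hc] using this
  -- curvature bound with `A' = max A 0 ≥ 0`
  have hA' : 0 ≤ max A 0 := le_max_right _ _
  have hcurv : c - 2 * b + a ≤ max A 0 * b / (k : ℝ) ^ 2 := by
    have h1 := hA k hk
    have h2 : A * b / (k : ℝ) ^ 2 ≤ max A 0 * b / (k : ℝ) ^ 2 := by
      apply div_le_div_of_nonneg_right _ (by positivity)
      exact mul_le_mul_of_nonneg_right (le_max_left _ _) hbpos.le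
    simpa [ha, hb, hc] using h1.trans h2
  -- `(b - c)² ≤ c (c - 2b + a) ≤ b · A' b / k²`
  have hsq : (b - c) ^ 2 ≤ max A 0 * b ^ 2 / (k : ℝ) ^ 2 := by
    have h1 : (b - c) ^ 2 ≤ c * (c - 2 * b + a) := by nlinarith
    have h2 : c * (c - 2 * b + a) ≤ b * (max A 0 * b / (k : ℝ) ^ 2) := by
      have hnn : 0 ≤ c - 2 * b + a := by nlinarith
      exact mul_le_mul hcb hcurv hnn hbpos.le
    calc (b - c) ^ 2 ≤ b * (max A 0 * b / (k : ℝ) ^ 2) := h1.trans h2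
      _ = max A 0 * b ^ 2 / (k : ℝ) ^ 2 := by ring
  have hbc : 0 ≤ b - c := by linarith
  have htarget : b - c ≤ Real.sqrt (max A 0) * b / k := by
    have hrhs : 0 ≤ Real.sqrt (max A 0) * b / k := by positivity
    have hsq' : (b - c) ^ 2 ≤ (Real.sqrt (max A 0) * b / k) ^ 2 := by
      rw [div_pow, mul_pow, Real.sq_sqrt hA']
      simpa [div_eq_mul_inv, mul_pow] using hsq
    exact (sq_le_sq₀ hbc hrhs).1 hsq'
  simpa [hb, hc] using htarget

/-- **CURVATURE SPLIT (census Decomposition D2 / line `curvature-split`)**: pieces (i) and (ii) give item 6150. -/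
theorem twoPointDoubling_of_axialKato_of_transverseDipole (h₁ : AxialKatoBound) (h₂ : TransverseDipoleBound) :
    UnitLightCone.TwoPointDoubling :=
  twoPointDoubling_of_axialCurvature (axialCurvature_of_axialKato_of_transverseDipole h₁ h₂)

/-! ## Piece (i) is NECESSARY: 6150 ⟹ axial curvature bound ⟹ axial Kato bound (third-order complete monotonicity + MMS) -/

/-- First differences `d(m) = g(m) − g(m+1)` and shifted second differences `D2(m) = g(m+2) − 2g(m+1) + g(m) = δ²g(m+1)`. -/
def d (m : ℕ) : ℝ := g m - g (m + 1)
/-- see `d`. -/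
def D2 (m : ℕ) : ℝ := g (m + 2) - 2 * g (m + 1) + g m

theorem d_nonneg (m : ℕ) : 0 ≤ d m := by
  have := Funnel.criticalTwoPoint_axis_antitone 0 (Nat.le_succ m)
  simp only [d, g]; linarith [this]

theorem d_sub_d (m : ℕ) : d m - d (m + 1) = D2 m := by simp only [d, D2]; ring

/-- Third-order complete monotonicity: `δ²g` is non-increasing, `D2(n+1) ≤ D2(n)`
(`g(n) − 3g(n+1) + 3g(n+2) − g(n+3) ≥ 0`, `FoldedCurrentRepulsion.criticalAxis_completelyMonotone` at order 3). -/
theorem D2_succ_le (n : ℕ) : D2 (n + 1) ≤ D2 n := by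
  have h := FoldedCurrentRepulsion.criticalAxis_completelyMonotone 0 3 n
  have h31 : Nat.choose 3 1 = 3 := by decide
  have h32 : Nat.choose 3 2 = 3 := by decide
  simp only [Finset.sum_range_succ, Finset.sum_range_zero, Nat.choose_zero_right, Nat.choose_self, h31, h32] at h
  norm_num at h
  simp only [D2, g]
  push_cast at h ⊢
  ring_nf at h ⊢
  linarith [h]

theorem mul_D2_le (m : ℕ) : ∀ t : ℕ, (t : ℝ) * D2 (m + t) ≤ d m - d (m + t) := by
  intro t
  induction t with
  | zero => simp
  | succ t ih =>
    have hanti : D2 (m + t + 1) ≤ D2 (m + t) := D2_succ_le (m + t)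
    have hstep : d m - d (m + (t + 1)) = (d m - d (m + t)) + D2 (m + t) := by
      rw [show m + (t + 1) = m + t + 1 by ring, ← d_sub_d (m + t)]; ring
    rw [hstep]
    have ht0 : (0 : ℝ) ≤ t := by positivity
    push_cast
    rw [show m + (t + 1) = m + t + 1 by ring]
    nlinarith [ih, hanti, ht0]

/-- **6150 ⟹ the axial curvature bound** `δ²g(k) ≤ A' g(k)/k²` (rate form of 6150 + third-order CM + doubling downwards). -/
theorem axialCurvature_of_twoPointDoubling (hD : UnitLightCone.TwoPointDoubling) : AxialCurvatureBound := by
  have hrate := (Funnel.twoPointDoubling_iff_axisGradientRate).1 (ulc_iff_mhc.1 hD)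
  obtain ⟨A, hA⟩ := hrate
  obtain ⟨κ, hκ, hdoub⟩ := hD
  -- doubling in `g`-notation
  have hdoub' : ∀ n : ℕ, 1 ≤ n → κ * g n ≤ g (2 * n) := by
    intro n hn
    have := hdoub n hn
    rw [Funnel.criticalTwoPoint_two_mul] at this
    exact this
  -- rate in `d`-notation with `A₀ = max A 0`
  set A₀ : ℝ := max A 0 with hA₀
  have hA₀nn : 0 ≤ A₀ := le_max_right _ _
  have hrate' : ∀ m : ℕ, 1 ≤ m → d m ≤ A₀ * g m / m := by
    intro m hm
    have h1 := hA m hm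
    have hm0 : (0 : ℝ) < m := by exact_mod_cast hm
    have h2 : A * g m / m ≤ A₀ * g m / m :=
      div_le_div_of_nonneg_right (mul_le_mul_of_nonneg_right (le_max_left _ _) (g_pos m).le) hm0.le
    simp only [d, g] at h1 ⊢
    exact h1.trans h2
  -- the first ratio `r₁ = g(2)/g(1)` bounds every later ratio from below
  set r₁ : ℝ := g 2 / g 1 with hr₁
  have hr₁pos : 0 < r₁ := div_pos (g_pos 2) (g_pos 1)
  have hratio : ∀ n : ℕ, 1 ≤ n → r₁ * g n ≤ g (n + 1) := by
    intro n hn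
    have hmono := criticalTwoPoint_axis_ratio_mono 0 (show 0 ≤ n - 1 from Nat.zero_le _)
    simp only at hmono
    rw [show n - 1 + 2 = n + 1 by omega, show n - 1 + 1 = n by omega] at hmono
    have hgn : 0 < g n := g_pos n
    have : g 2 / g 1 ≤ g (n + 1) / g n := by simpa [g] using hmono
    rw [hr₁]
    rwa [le_div_iff₀ hgn] at this
  -- constants
  refine ⟨max (18 * A₀ / (r₁ * κ)) (max (2 / g 1) (8 / g 2)), fun k hk => ?_⟩
  set C : ℝ := max (18 * A₀ / (r₁ * κ)) (max (2 / g 1) (8 / g 2)) with hC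
  have hg_le_one : ∀ m, g m ≤ 1 := fun m => criticalTwoPoint_le_one' _
  have hg_nn : ∀ m, 0 ≤ g m := fun m => (g_pos m).le
  -- the target is `D2 (k-1) ≤ C g(k)/k²`
  have htarget : D2 (k - 1) ≤ C * g k / (k : ℝ) ^ 2 := by
    rcases (show k = 1 ∨ k = 2 ∨ 3 ≤ k by omega) with rfl | rfl | hk3
    · -- k = 1: `D2 0 ≤ 2 ≤ (2/g 1) g 1`
      have hD : D2 0 ≤ 2 := by
        simp only [D2]; nlinarith [hg_le_one 2, hg_le_one 0, hg_nn 1]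
      have hC1 : 2 / g 1 ≤ C := (le_max_left _ _).trans (le_max_right _ _)
      have : (2 / g 1) * g 1 / ((1 : ℕ) : ℝ) ^ 2 = 2 := by
        field_simp [(g_pos 1).ne']; push_cast; ring
      calc D2 (1 - 1) = D2 0 := rfl
        _ ≤ 2 := hD
        _ = (2 / g 1) * g 1 / ((1 : ℕ) : ℝ) ^ 2 := this.symm
        _ ≤ C * g 1 / ((1 : ℕ) : ℝ) ^ 2 := by
            apply div_le_div_of_nonneg_right _ (by positivity)
            exact mul_le_mul_of_nonneg_right hC1 (hg_nn 1)
    · -- k = 2: `D2 1 ≤ 2 ≤ (8/g 2) g 2 / 4`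
      have hD : D2 1 ≤ 2 := by
        simp only [D2]; nlinarith [hg_le_one 3, hg_le_one 1, hg_nn 2]
      have hC2 : 8 / g 2 ≤ C := (le_max_right _ _).trans (le_max_right _ _)
      have : (8 / g 2) * g 2 / ((2 : ℕ) : ℝ) ^ 2 = 2 := by
        field_simp [(g_pos 2).ne']; push_cast; ring
      calc D2 (2 - 1) = D2 1 := rfl
        _ ≤ 2 := hD
        _ = (8 / g 2) * g 2 / ((2 : ℕ) : ℝ) ^ 2 := this.symm
        _ ≤ C * g 2 / ((2 : ℕ) : ℝ) ^ 2 := by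
            apply div_le_div_of_nonneg_right _ (by positivity)
            exact mul_le_mul_of_nonneg_right hC2 (hg_nn 2)
    · -- k ≥ 3: K = k - 1, t = K/2, m = K - t
      set K : ℕ := k - 1 with hK
      set t : ℕ := K / 2 with ht
      set m : ℕ := K - t with hm
      have hmt : m + t = K := by omega
      have hm1 : 1 ≤ m := by omega
      have ht1 : 1 ≤ t := by omega
      have h3m : k ≤ 3 * m := by omega
      have h6t : k ≤ 6 * t := by omega
      have hk2m : k ≤ 2 * m + 1 := by omega
      have hk0 : (0 : ℝ) < k := by exact_mod_cast (show 0 < k by omega)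
      have hm0 : (0 : ℝ) < m := by exact_mod_cast hm1
      have ht0 : (0 : ℝ) < t := by exact_mod_cast ht1
      -- (a) `t · D2 K ≤ d m ≤ A₀ g m / m`
      have ha : (t : ℝ) * D2 K ≤ A₀ * g m / m := by
        have h1 := mul_D2_le m t
        rw [hmt] at h1
        have h2 : d m - d K ≤ d m := by linarith [d_nonneg K]
        exact h1.trans (h2.trans (hrate' m hm1))
      -- (b) `g m ≤ g k / (r₁ κ)`: `g k ≥ g (2m+1) ≥ r₁ g(2m) ≥ r₁ κ g m`
      have hb : r₁ * κ * g m ≤ g k := by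
        have h1 : κ * g m ≤ g (2 * m) := hdoub' m hm1
        have h2 : r₁ * g (2 * m) ≤ g (2 * m + 1) := hratio (2 * m) (by omega)
        have h3 : g (2 * m + 1) ≤ g k := Funnel.criticalTwoPoint_axis_antitone 0 hk2m
        nlinarith [h1, h2, h3, hr₁pos.le, hκ.le]
      -- (c) combine: `D2 K ≤ A₀ g m /(m t) ≤ (18 A₀/(r₁κ)) g k / k²`
      have hmt_ge : (k : ℝ) ^ 2 ≤ 18 * ((m : ℝ) * t) := by
        have h1 : (k : ℝ) ≤ 3 * m := by exact_mod_cast h3m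
        have h2 : (k : ℝ) ≤ 6 * t := by exact_mod_cast h6t
        nlinarith [h1, h2, hk0.le]
      have hD2 : D2 K ≤ A₀ * g m / ((m : ℝ) * t) := by
        rw [le_div_iff₀ (mul_pos hm0 ht0)]
        have := ha
        rw [le_div_iff₀ hm0] at this
        nlinarith [this]
      have hgm : g m ≤ g k / (r₁ * κ) := by
        rw [le_div_iff₀ (mul_pos hr₁pos hκ)]; nlinarith [hb]
      have hC3 : 18 * A₀ / (r₁ * κ) ≤ C := le_max_left _ _
      have hKk : K = k - 1 := rfl
      calc D2 (k - 1) = D2 K := by rw [hKk]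
        _ ≤ A₀ * g m / ((m : ℝ) * t) := hD2
        _ ≤ A₀ * (g k / (r₁ * κ)) / ((m : ℝ) * t) := by
            apply div_le_div_of_nonneg_right _ (by positivity)
            exact mul_le_mul_of_nonneg_left hgm hA₀nn
        _ = (18 * A₀ / (r₁ * κ)) * g k / (18 * ((m : ℝ) * t)) := by
            field_simp
        _ ≤ (18 * A₀ / (r₁ * κ)) * g k / (k : ℝ) ^ 2 := by
            apply div_le_div_of_nonneg_left _ (by positivity) hmt_ge
            exact mul_nonneg (div_nonneg (by positivity) (mul_pos hr₁pos hκ).le) (hg_nn k)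
        _ ≤ C * g k / (k : ℝ) ^ 2 := by
            apply div_le_div_of_nonneg_right _ (by positivity)
            exact mul_le_mul_of_nonneg_right hC3 (hg_nn k)
  -- rewrite `D2 (k-1)` as the curvature at `k`
  have hidx : D2 (k - 1) = criticalTwoPoint 3 (Pi.single 0 ((k + 1 : ℕ) : ℤ)) - 2 * criticalTwoPoint 3 (Pi.single 0 (k : ℤ)) +
      criticalTwoPoint 3 (Pi.single 0 ((k - 1 : ℕ) : ℤ)) := by
    simp only [D2, g]
    rw [show k - 1 + 2 = k + 1 by omega, show k - 1 + 1 = k by omega]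
  rw [hidx] at htarget
  exact htarget

/-- **Axial curvature bound ⟹ axial Kato bound** (the transverse part of the Laplacian at `ke₀` is `≤ 0` by MMS + cubic symmetry). -/
theorem axialKato_of_axialCurvature (h : AxialCurvatureBound) : AxialKatoBound := by
  obtain ⟨A, hA⟩ := h
  obtain ⟨hrefl, hperm, hmms⟩ := criticalTwoPoint_symm_facts
  refine ⟨A, fun k hk => ?_⟩
  have hcurv := hA k hk
  set x₀ : Site 3 := Pi.single 0 (k : ℤ) with hx₀
  -- transverse neighbours are `≤ g(k)`
  have hplus_le : ∀ i : Fin 3, i ≠ 0 → criticalTwoPoint 3 (x₀ + Pi.single i 1) ≤ criticalTwoPoint 3 x₀ := by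
    intro i hi
    exact hmms x₀ i (by rw [hx₀]; simp [Pi.single_apply, hi])
  have hneg : ∀ i : Fin 3, i ≠ 0 →
      criticalTwoPoint 3 (x₀ - Pi.single i 1) = criticalTwoPoint 3 (x₀ + Pi.single i 1) := by
    intro i hi
    have := hrefl i (x₀ + Pi.single i 1)
    have heq : Function.update (x₀ + Pi.single i 1) i (-((x₀ + Pi.single i 1 : Site 3) i)) = x₀ - Pi.single i 1 := by
      funext j
      by_cases hj : j = i
      · subst hj
        simp [hx₀, hi]
      · simp [Pi.sub_apply, Pi.add_apply, hj]
    rw [heq] at this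
    exact this
  have hsplit : (∑ i : Fin 3, (criticalTwoPoint 3 (x₀ + Pi.single i 1) + criticalTwoPoint 3 (x₀ - Pi.single i 1))) =
      (criticalTwoPoint 3 (x₀ + Pi.single 0 1) + criticalTwoPoint 3 (x₀ - Pi.single 0 1)) +
      ((criticalTwoPoint 3 (x₀ + Pi.single 1 1) + criticalTwoPoint 3 (x₀ - Pi.single 1 1)) +
        (criticalTwoPoint 3 (x₀ + Pi.single 2 1) + criticalTwoPoint 3 (x₀ - Pi.single 2 1))) := by
    rw [Fin.sum_univ_three]; ring
  have hplus : x₀ + Pi.single 0 1 = Pi.single 0 (((k + 1 : ℕ) : ℤ)) := by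
    rw [hx₀, ← Pi.single_add]; push_cast; rfl
  have hminus : x₀ - Pi.single 0 1 = Pi.single 0 (((k - 1 : ℕ) : ℤ)) := by
    rw [hx₀, ← Pi.single_sub]
    congr 1
    push_cast [Nat.cast_sub hk]
    ring
  rw [hsplit, hplus, hminus, hneg 1 one_ne_zero, hneg 2 (by decide)]
  have h1 := hplus_le 1 one_ne_zero
  have h2 := hplus_le 2 (by decide)
  rw [hx₀] at h1 h2 hcurv ⊢
  linarith

/-- **6150 ⟹ piece (i)** (`AxialKatoBound`): the axial one-sided Kato bound is a NECESSARY condition for the crux. -/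
theorem axialKato_of_twoPointDoubling (hD : UnitLightCone.TwoPointDoubling) : AxialKatoBound :=
  axialKato_of_axialCurvature (axialCurvature_of_twoPointDoubling hD)

/-! ## REGIME RESHAPE of the birth line: lean (landed) + heavy (landed) + anomalous (open) -/

/-- **D1**: the anomalous-regime statement closes item 6150, the other two regimes being theorems of the tree
(`Birth.stub_leanScalePropagation`, p142463; `FoldedCurrentRepulsion.heavyScale_doubling`, p145487). -/
theorem twoPointDoubling_of_anomalous (h : AnomalousRegimeDoubling) : UnitLightCone.TwoPointDoubling := by
  obtain ⟨A, hA, T, hT, κ₃, hκ₃, h₃⟩ := h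
  obtain ⟨κ₁, hκ₁, h₁⟩ := Birth.stub_leanScalePropagation A hA
  obtain ⟨κ₂, hκ₂, h₂⟩ := FoldedCurrentRepulsion.heavyScale_doubling T hT
  refine ⟨min κ₁ (min κ₂ κ₃), lt_min hκ₁ (lt_min hκ₂ hκ₃), fun n hn => ?_⟩
  have hg0 : 0 ≤ criticalTwoPoint 3 (Pi.single 0 (n : ℤ)) := (g_pos n).le
  by_cases hlean : ∀ k : ℕ, 1 ≤ k → k ≤ 8 * n →
      criticalTwoPoint 3 (Pi.single 0 (k : ℤ)) ≤ A * (k : ℝ) ^ (-(3 : ℝ) / 2)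
  · calc min κ₁ (min κ₂ κ₃) * criticalTwoPoint 3 (Pi.single 0 (n : ℤ))
          ≤ κ₁ * criticalTwoPoint 3 (Pi.single 0 (n : ℤ)) := mul_le_mul_of_nonneg_right (min_le_left _ _) hg0
      _ ≤ _ := h₁ n hn hlean
  · push Not at hlean
    obtain ⟨k, hk1, hk8, hfat⟩ := hlean
    by_cases hheavy : T ≤ (n : ℝ) * criticalTwoPoint 3 (Pi.single 0 (n : ℤ))
    · calc min κ₁ (min κ₂ κ₃) * criticalTwoPoint 3 (Pi.single 0 (n : ℤ))
            ≤ κ₂ * criticalTwoPoint 3 (Pi.single 0 (n : ℤ)) :=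
              mul_le_mul_of_nonneg_right ((min_le_right _ _).trans (min_le_left _ _)) hg0
        _ ≤ _ := h₂ n hn hheavy
    · push Not at hheavy
      calc min κ₁ (min κ₂ κ₃) * criticalTwoPoint 3 (Pi.single 0 (n : ℤ))
            ≤ κ₃ * criticalTwoPoint 3 (Pi.single 0 (n : ℤ)) :=
              mul_le_mul_of_nonneg_right ((min_le_right _ _).trans (min_le_right _ _)) hg0
        _ ≤ _ := h₃ n hn hheavy ⟨k, hk1, hk8, hfat⟩

end Summit.CriticalPhenomena.Ising3DConformalLimit.Cruxes.TwoPointDoubling.StrategistB1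

end
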